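import Mathlib
import HarnessLib
import Summits.Ventures.LatticeQCDFlow.Scoring.SectorBottleneckFloor
import Summits.Ventures.LatticeQCDFlow.Scoring.DoeblinSkeleton

/-!
# The two-time law behind `autocov`, and the LINEAR LAW of sector autocorrelations for every exact
# sampler: `ρ_t(1_A) ≥ 1 − t·Φ/(π(A)(1 − π(A)))`, `Φ` the one-step exit flux

HONEST FRAMING: exact (Metropolis-corrected) sampling algorithms for lattice gauge theory;
figures of merit are autocorrelation/cost numbers at stated couplings and volumes; no
continuum-physics claim.

Venture `LatticeQCDFlow` (cell pub-lqcd), topic `Scoring`; FANOUT row 8 (`s0-cpn-nemc`, GEN-12).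
NEW WORK of the cell, not a published result; no definition is introduced.  Two dictionaries and one
inequality over Mathlib's `Measure.compProd` / `Measure.bind`, row 9's iterate `nHit`
(`Exactness/InvariantComposition.lean`) and two-event covariance `setAutocov`
(`Exactness/DoeblinAutocovariance.lean`), and this row's `kop` / `autocov`
(`Scoring/KernelTransitionOperator.lean`), `kop_nHit` (`Scoring/DoeblinSkeleton.lean`) and the
sector identities of `Scoring/SectorBottleneckFloor.lean`.  Printed counterpart NAMED ONLY: the
union-bound / first-exit argument behind theory-2's `Tunnelling.sectorAutocov_ge`
(`Scaling/TunnellingLaws.lean`, a statement about a process on a probability space); here the same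
law is proved at KERNEL level, for the stationary chain of any `π`-invariant Markov kernel, with no
path space.

## Content (`κ` Markov, `π` an invariant probability law; `A` measurable, `a = π(A)`;
## `Φ = (π ⊗ₘ κ)(A ×ˢ Aᶜ)` the stationary one-step exit flux)

* §1 THE TWO-TIME LAW: `autocov_eq_autocov_nHit_one` (`C_g^κ(t) = C_g^{κᵗ}(1)`: lag `t` of `κ` is lag
  one of the `t`-step kernel `nHit κ t`), **`integral_mul_iterate_kop_eq_integral_compProd`**
  (`∫ g · (kop κ)^[t] f dπ = ∫ g(x) f(y) d(π ⊗ₘ κᵗ)(x, y)`: the operator form IS the expectation under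
  the joint law of `(X₀, X_t)`), `autocov_eq_integral_compProd`, `snd_compProd_nHit` (both marginals
  of that joint law are `π`), **`setAutocov_eq`** (row 9's two-event covariance is this row's
  cross-covariance of the two indicators: `setAutocov κ π t A B = ∫ 1_A · (kop κ)^[t] 1_B dπ − π(A)π(B)`),
  hence `abs_setAutocov_le_sqrt_of_doeblin` — under Doeblin by `π`,
  `|C_t(A, B)| ≤ (1 − ε)ᵗ √(π(A)(1 − π(A)) π(B)(1 − π(B)))` (the cross-covariance envelope of
  `Scoring/DoeblinCrossCovariance.lean`; complements row 9's `π(A)(1 − ε)ᵗ`).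
* §2 THE `t`-STEP EXIT FLUX IS AT MOST `t` ONE-STEP FLUXES (kernel-level union bound, invariance
  only, no reversibility): `exitFlux_nHit_succ_le`, `exitFlux_nHit_le_lintegral`, **`exitFlux_nHit_le`**
  (`(π ⊗ₘ κᵗ)(A ×ˢ Aᶜ) ≤ t · (π ⊗ₘ κ)(A ×ˢ Aᶜ)`).
* §3 THE LINEAR LAW: `autocov_centredIndicator_eq_stayMass` (`C_{1_A}(t) = s_t − a²`, `s_t` the
  `t`-step stay mass), **`autocov_centredIndicator_ge_linear`** (`C_{1_A}(t) ≥ a(1 − a) − t·Φ`) and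
  **`acf_centredIndicator_ge_linear`** (`ρ_t(1_A) ≥ 1 − t·Φ/(a(1 − a))` for `0 < a < 1`) — for EVERY
  exact sampler, reversible or not (heat-bath and over-relaxation sweeps included): a sector whose
  stationary tunnelling flux per step is `Φ` keeps autocorrelation `≥ 1 − tΦ/(a(1 − a))` at lag `t`.

Reading (value-free): with theory-2's kernel law `Φ ≤ (π ⊗ κ){Q ≠ Q'} ≤ 2π(B)` for a separating
set `B` this is the typed `τ_top ≳ 1/π(between the sectors)` diagnosis at every lag and for every
algorithm; for REVERSIBLE samplers `Scoring/SectorBottleneckFloor.lean` gives the sharper integrated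
form `τ_int(1_A) ≥ a(1 − a)/Φ − 1/2`.  NOT CLAIMED: any number of ours; `τ_int` consequences for
non-reversible kernels beyond the lag-wise law (the tail of `ρ` is not sign-controlled there).
-/

noncomputable section

namespace Summit.Ventures.LatticeQCDFlow.Scoring

open MeasureTheory ProbabilityTheory Filter Set Summit.Ventures.LatticeQCDFlow.Exactness
open scoped ENNReal

variable {Ω : Type*} [MeasurableSpace Ω]

/-! ### §1 The two-time law -/

section TwoTime

variable {κ : Kernel Ω Ω} [IsMarkovKernel κ] {π : Measure Ω} [IsProbabilityMeasure π]

omit [IsProbabilityMeasure π] in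
/-- Lag `t` of `κ` is lag one of the `t`-step kernel: `autocov κ π g t = autocov (nHit κ t) π g 1`. -/
theorem autocov_eq_autocov_nHit_one {g : Ω → ℝ} (hg : Measurable g) {C : ℝ} (hC : ∀ x, |g x| ≤ C)
    (t : ℕ) : autocov κ π g t = autocov (nHit κ t) π g 1 := by
  unfold autocov
  rw [Function.iterate_one, kop_nHit κ t hg hC]

/-- **The operator form is the two-time expectation**: for bounded measurable `f, g`,
`∫ g · (kop κ)^[t] f dπ = ∫ g(x) f(y) d(π ⊗ₘ nHit κ t)(x, y)` — the joint law of `(X₀, X_t)` for the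
chain started in `π`. -/
theorem integral_mul_iterate_kop_eq_integral_compProd {f g : Ω → ℝ} (hf : Measurable f) {Cf : ℝ}
    (hCf : ∀ x, |f x| ≤ Cf) (hg : Measurable g) {Cg : ℝ} (hCg : ∀ x, |g x| ≤ Cg) (t : ℕ) :
    ∫ x, g x * (kop κ)^[t] f x ∂π = ∫ p, g p.1 * f p.2 ∂(π ⊗ₘ nHit κ t) := by
  haveI := isMarkovKernel_nHit κ t
  have hint : Integrable (fun p : Ω × Ω => g p.1 * f p.2) (π ⊗ₘ nHit κ t) :=
    integrable_of_bounded _ ((hg.comp measurable_fst).mul (hf.comp measurable_snd)) (C := Cg * Cf)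
      fun p => by
        rw [abs_mul]
        exact mul_le_mul (hCg p.1) (hCf p.2) (abs_nonneg _) ((abs_nonneg _).trans (hCg p.1))
  rw [Measure.integral_compProd hint, ← kop_nHit κ t hf hCf]
  refine integral_congr_ae (ae_of_all _ fun x => ?_)
  show g x * kop (nHit κ t) f x = ∫ y, g x * f y ∂(nHit κ t x)
  rw [integral_const_mul]
  rfl

/-- `autocov κ π f t = ∫ f(x) f(y) d(π ⊗ₘ nHit κ t)(x, y)`. -/
theorem autocov_eq_integral_compProd {f : Ω → ℝ} (hf : Measurable f) {C : ℝ} (hC : ∀ x, |f x| ≤ C)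
    (t : ℕ) : autocov κ π f t = ∫ p, f p.1 * f p.2 ∂(π ⊗ₘ nHit κ t) :=
  integral_mul_iterate_kop_eq_integral_compProd hf hC hf hC t

omit [IsProbabilityMeasure π] in
/-- Both marginals of the two-time law are `π` (the second by invariance). -/
theorem snd_compProd_nHit [SFinite π] (hπ : Kernel.Invariant κ π) (t : ℕ) :
    (π ⊗ₘ nHit κ t).fst = π ∧ (π ⊗ₘ nHit κ t).snd = π := by
  haveI := isMarkovKernel_nHit κ t
  refine ⟨Measure.fst_compProd π (nHit κ t), ?_⟩
  rw [Measure.snd_compProd]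
  exact (invariant_nHit hπ t).def

omit [IsProbabilityMeasure π] in
/-- `∫ 1_A · kop η 1_B dπ = ∫_A η(x, B) dπ` for any Markov kernel `η`. -/
theorem integral_indicator_mul_kop_indicator' (η : Kernel Ω Ω) [IsMarkovKernel η] {A B : Set Ω}
    (hA : MeasurableSet A) (hB : MeasurableSet B) :
    ∫ x, A.indicator (1 : Ω → ℝ) x * kop η (B.indicator (1 : Ω → ℝ)) x ∂π
      = ∫ x in A, (η x).real B ∂π := by
  rw [← integral_indicator hA]
  refine integral_congr_ae (ae_of_all _ fun x => ?_)
  by_cases hx : x ∈ A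
  · simp [hx, kop_indicator hB]
  · simp [hx]

omit [IsProbabilityMeasure π] in
/-- `∫_A η(x, B) dπ = (π ⊗ₘ η)(A ×ˢ B)` as a real number. -/
theorem setIntegral_real_eq_compProd [SFinite π] (η : Kernel Ω Ω) [IsMarkovKernel η] {A B : Set Ω}
    (hA : MeasurableSet A) (hB : MeasurableSet B) :
    ∫ x in A, (η x).real B ∂π = ((π ⊗ₘ η) (A ×ˢ B)).toReal := by
  rw [Measure.compProd_apply_prod hA hB, ← integral_toReal
    ((Kernel.measurable_coe η hB).aemeasurable.restrict) (ae_of_all _ fun x => measure_lt_top _ _)]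
  rfl

/-- **Row 9's two-event covariance is this row's cross-covariance of indicators**:
`setAutocov κ π t A B = ∫ 1_A · (kop κ)^[t] 1_B dπ − π(A) π(B)`. -/
theorem setAutocov_eq {A B : Set Ω} (hA : MeasurableSet A) (hB : MeasurableSet B) (t : ℕ) :
    setAutocov κ π t A B
      = ∫ x, A.indicator (1 : Ω → ℝ) x * (kop κ)^[t] (B.indicator (1 : Ω → ℝ)) x ∂π
          - π.real A * π.real B := by
  haveI := isMarkovKernel_nHit κ t
  have h1m : Measurable (B.indicator (1 : Ω → ℝ)) := measurable_const.indicator hB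
  have h1b : ∀ x, |B.indicator (1 : Ω → ℝ) x| ≤ 1 := fun x => by
    by_cases hx : x ∈ B <;> simp [hx]
  rw [setAutocov, ← kop_nHit κ t h1m h1b, integral_indicator_mul_kop_indicator' (nHit κ t) hA hB,
    setIntegral_real_eq_compProd (nHit κ t) hA hB]

/-- **`|C_t(A, B)| ≤ (1 − ε)ᵗ √(π(A)(1 − π(A)) · π(B)(1 − π(B)))`** for every pair of events of a
Markov kernel minorised by its invariant law `π` (the cross-covariance envelope on indicators;
row 9's `abs_setAutocov_le` gives `π(A)(1 − ε)ᵗ` — neither bound dominates the other). -/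
theorem abs_setAutocov_le_sqrt_of_doeblin {ε : ℝ≥0∞} (hπ : Kernel.Invariant κ π)
    (hmin : ∀ x {B : Set Ω}, MeasurableSet B → ε * π B ≤ κ x B) {A B : Set Ω}
    (hA : MeasurableSet A) (hB : MeasurableSet B) (t : ℕ) :
    |setAutocov κ π t A B|
      ≤ (1 - ε.toReal) ^ t *
          (Real.sqrt (π.real A * (1 - π.real A)) * Real.sqrt (π.real B * (1 - π.real B))) := by
  have hAm : Measurable (A.indicator (1 : Ω → ℝ)) := measurable_const.indicator hA
  have hBm : Measurable (B.indicator (1 : Ω → ℝ)) := measurable_const.indicator hB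
  have hAb : ∀ x, |A.indicator (1 : Ω → ℝ) x| ≤ 1 := fun x => by
    by_cases hx : x ∈ A <;> simp [hx]
  have hBb : ∀ x, |B.indicator (1 : Ω → ℝ) x| ≤ 1 := fun x => by
    by_cases hx : x ∈ B <;> simp [hx]
  have h := abs_crossCov_le_of_doeblin hπ hmin hBm hBb hAm hAb t
  have hvA : ∫ x, (A.indicator (1 : Ω → ℝ) x - π.real A) ^ 2 ∂π = π.real A * (1 - π.real A) := by
    have h0 := autocov_centredIndicator_zero (κ := κ) (π := π) hA
    rw [autocov_zero] at h0
    exact h0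
  have hvB : ∫ x, (B.indicator (1 : Ω → ℝ) x - π.real B) ^ 2 ∂π = π.real B * (1 - π.real B) := by
    have h0 := autocov_centredIndicator_zero (κ := κ) (π := π) hB
    rw [autocov_zero] at h0
    exact h0
  rw [setAutocov_eq hA hB t]
  rw [integral_indicator_one hA, integral_indicator_one hB, hvA, hvB] at h
  exact h

end TwoTime

/-! ### §2 The `t`-step exit flux is at most `t` one-step fluxes -/

section Flux

variable {κ : Kernel Ω Ω} [IsMarkovKernel κ] {π : Measure Ω} [IsProbabilityMeasure π] {A : Set Ω}

omit [IsProbabilityMeasure π] in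
/-- One more step costs at most one one-step flux:
`∫_A κ^{t+1}(x, Aᶜ) dπ ≤ ∫_A κᵗ(x, Aᶜ) dπ + ∫_A κ(x, Aᶜ) dπ` (`π` invariant; to be outside `A` after
`t + 1` steps the chain was outside after `t` steps or left `A` at the last step, and by invariance
the law before the last step is dominated by `π`). -/
theorem exitFlux_nHit_succ_le [SFinite π] (hπ : Kernel.Invariant κ π) (hA : MeasurableSet A)
    (t : ℕ) :
    ∫⁻ x in A, nHit κ (t + 1) x Aᶜ ∂π
      ≤ ∫⁻ x in A, nHit κ t x Aᶜ ∂π + ∫⁻ x in A, κ x Aᶜ ∂π := by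
  haveI := isMarkovKernel_nHit κ t
  have hAc := hA.compl
  have hmeas : Measurable fun y => A.indicator (fun y => κ y Aᶜ) y :=
    (Kernel.measurable_coe κ hAc).indicator hA
  -- pointwise split of the last step
  have hpt : ∀ x, nHit κ (t + 1) x Aᶜ
      ≤ nHit κ t x Aᶜ + ∫⁻ y, A.indicator (fun y => κ y Aᶜ) y ∂(nHit κ t x) := by
    intro x
    rw [nHit_succ, Kernel.comp_apply' _ _ _ hAc, ← lintegral_add_compl _ hA, add_comm,
      lintegral_indicator hA]
    refine add_le_add ?_ le_rfl
    calc ∫⁻ y in Aᶜ, κ y Aᶜ ∂(nHit κ t x) ≤ ∫⁻ _ in Aᶜ, 1 ∂(nHit κ t x) :=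
          setLIntegral_mono measurable_const fun y _ => prob_le_one
      _ = nHit κ t x Aᶜ := by rw [setLIntegral_const, one_mul]
  -- integrate over `x ∈ A`, extend the outer integral to `Ω`, use invariance of `π` under `κᵗ`
  calc ∫⁻ x in A, nHit κ (t + 1) x Aᶜ ∂π
      ≤ ∫⁻ x in A, (nHit κ t x Aᶜ + ∫⁻ y, A.indicator (fun y => κ y Aᶜ) y ∂(nHit κ t x)) ∂π :=
        setLIntegral_mono' hA fun x _ => hpt x
    _ = ∫⁻ x in A, nHit κ t x Aᶜ ∂π
          + ∫⁻ x in A, ∫⁻ y, A.indicator (fun y => κ y Aᶜ) y ∂(nHit κ t x) ∂π := by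
        rw [lintegral_add_left (Kernel.measurable_coe (nHit κ t) hAc)]
    _ ≤ ∫⁻ x in A, nHit κ t x Aᶜ ∂π
          + ∫⁻ x, ∫⁻ y, A.indicator (fun y => κ y Aᶜ) y ∂(nHit κ t x) ∂π :=
        add_le_add le_rfl (setLIntegral_le_lintegral _ _)
    _ = ∫⁻ x in A, nHit κ t x Aᶜ ∂π + ∫⁻ y, A.indicator (fun y => κ y Aᶜ) y ∂(π.bind (nHit κ t)) := by
        rw [Measure.lintegral_bind (Kernel.aemeasurable _) hmeas.aemeasurable]
    _ = ∫⁻ x in A, nHit κ t x Aᶜ ∂π + ∫⁻ x in A, κ x Aᶜ ∂π := by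
        rw [(invariant_nHit hπ t).def, lintegral_indicator hA]

omit [IsProbabilityMeasure π] in
/-- **The `t`-step exit flux is at most `t` one-step fluxes** (set-integral form):
`∫_A κᵗ(x, Aᶜ) dπ ≤ t · ∫_A κ(x, Aᶜ) dπ` (`π` invariant; no reversibility). -/
theorem exitFlux_nHit_le_lintegral [SFinite π] (hπ : Kernel.Invariant κ π) (hA : MeasurableSet A) :
    ∀ t : ℕ, ∫⁻ x in A, nHit κ t x Aᶜ ∂π ≤ t * ∫⁻ x in A, κ x Aᶜ ∂π
  | 0 => by
    simp only [nHit_zero, Kernel.id_apply, Nat.cast_zero, zero_mul, nonpos_iff_eq_zero]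
    refine (setLIntegral_congr_fun hA (fun x hx => ?_)).trans (by rw [lintegral_zero])
    rw [Measure.dirac_apply' _ hA.compl]
    simp [hx]
  | t + 1 => by
    calc ∫⁻ x in A, nHit κ (t + 1) x Aᶜ ∂π
        ≤ ∫⁻ x in A, nHit κ t x Aᶜ ∂π + ∫⁻ x in A, κ x Aᶜ ∂π := exitFlux_nHit_succ_le hπ hA t
      _ ≤ t * ∫⁻ x in A, κ x Aᶜ ∂π + ∫⁻ x in A, κ x Aᶜ ∂π :=
          add_le_add (exitFlux_nHit_le_lintegral hπ hA t) le_rfl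
      _ = (t + 1 : ℕ) * ∫⁻ x in A, κ x Aᶜ ∂π := by push_cast; ring

omit [IsProbabilityMeasure π] in
/-- **The `t`-step exit flux is at most `t` one-step fluxes**:
`(π ⊗ₘ κᵗ)(A ×ˢ Aᶜ) ≤ t · (π ⊗ₘ κ)(A ×ˢ Aᶜ)` (`π` invariant; no reversibility). -/
theorem exitFlux_nHit_le [SFinite π] (hπ : Kernel.Invariant κ π) (hA : MeasurableSet A) (t : ℕ) :
    (π ⊗ₘ nHit κ t) (A ×ˢ Aᶜ) ≤ t * (π ⊗ₘ κ) (A ×ˢ Aᶜ) := by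
  haveI := isMarkovKernel_nHit κ t
  rw [Measure.compProd_apply_prod hA hA.compl, Measure.compProd_apply_prod hA hA.compl]
  exact exitFlux_nHit_le_lintegral hπ hA t

end Flux

/-! ### §3 The linear law of sector autocorrelations -/

section Linear

variable {κ : Kernel Ω Ω} [IsMarkovKernel κ] {π : Measure Ω} [IsProbabilityMeasure π] {A : Set Ω}

/-- `C_{1_A}(t) = s_t − a²` with `s_t = ∫_A κᵗ(x, A) dπ` the `t`-step stay mass. -/
theorem autocov_centredIndicator_eq_stayMass (hπ : Kernel.Invariant κ π) (hA : MeasurableSet A)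
    (t : ℕ) :
    autocov κ π (fun x => A.indicator (1 : Ω → ℝ) x - π.real A) t
      = ∫ x in A, (nHit κ t x).real A ∂π - π.real A ^ 2 := by
  haveI := isMarkovKernel_nHit κ t
  rw [autocov_eq_autocov_nHit_one (measurable_centredIndicator hA _) (abs_centredIndicator_le A) t,
    autocov_centredIndicator_one (invariant_nHit hπ t) hA]

/-- **THE LINEAR LAW (autocovariance form)**: for every Markov kernel with invariant probability law
`π` and every measurable `A`: `C_{1_A}(t) ≥ π(A)(1 − π(A)) − t · Φ`,
`Φ = (π ⊗ₘ κ)(A ×ˢ Aᶜ)` the one-step exit flux. -/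
theorem autocov_centredIndicator_ge_linear (hπ : Kernel.Invariant κ π) (hA : MeasurableSet A)
    (t : ℕ) :
    π.real A * (1 - π.real A) - t * ((π ⊗ₘ κ) (A ×ˢ Aᶜ)).toReal
      ≤ autocov κ π (fun x => A.indicator (1 : Ω → ℝ) x - π.real A) t := by
  haveI := isMarkovKernel_nHit κ t
  have hflux := flux_eq_compProd (κ := nHit κ t) (π := π) hA
  have hle : ((π ⊗ₘ nHit κ t) (A ×ˢ Aᶜ)).toReal ≤ t * ((π ⊗ₘ κ) (A ×ˢ Aᶜ)).toReal := by
    have h := ENNReal.toReal_mono (ENNReal.mul_ne_top (ENNReal.natCast_ne_top t)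
      (measure_ne_top _ _)) (exitFlux_nHit_le hπ hA t)
    rwa [ENNReal.toReal_mul, ENNReal.toReal_natCast] at h
  rw [autocov_centredIndicator_eq_stayMass hπ hA t]
  nlinarith

/-- **THE LINEAR LAW**: `ρ_t(1_A) ≥ 1 − t · Φ/(π(A)(1 − π(A)))` for every exact sampler (reversible
or not), every sector with `0 < π(A) < 1` and every lag `t`. -/
theorem acf_centredIndicator_ge_linear (hπ : Kernel.Invariant κ π) (hA : MeasurableSet A)
    (ha0 : 0 < π.real A) (ha1 : π.real A < 1) (t : ℕ) :
    1 - t * ((π ⊗ₘ κ) (A ×ˢ Aᶜ)).toReal / (π.real A * (1 - π.real A))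
      ≤ autocov κ π (fun x => A.indicator (1 : Ω → ℝ) x - π.real A) t
          / autocov κ π (fun x => A.indicator (1 : Ω → ℝ) x - π.real A) 0 := by
  have hvar : 0 < π.real A * (1 - π.real A) := mul_pos ha0 (by linarith)
  rw [autocov_centredIndicator_zero hA, le_div_iff₀ hvar, sub_mul, one_mul,
    div_mul_cancel₀ _ hvar.ne']
  exact autocov_centredIndicator_ge_linear hπ hA t

end Linear

end Summit.Ventures.LatticeQCDFlow.Scoring

end
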